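import Mathlib
import HarnessLib
import Summits.Langlands.Langlands.Theses.AnalyticDescent
import Literature.NumberTheory.Automorphic.ReciprocityGLnDescentProofs
import Literature.NumberTheory.Automorphic.ReciprocityGLnPatchingGalois

/-! BC5 special case (degenerate tower `F' = F`) of crux stmt-Langlands-2209 `DescentGL2` — sanity that the
definitions compute: the hypothesis at `E := F` already gives the conclusion, up to transporting
`SatakeFrobCompatibleAt` from `ρ.restrictField F` (restriction along the chosen `Γ_F → Γ_F`) back to `ρ`. -/

open Summit.Langlands.Langlands.Theses.AnalyticDescent
open Literature.NumberTheory.GaloisRepresentations Literature.NumberTheory.Automorphic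
open NumberField IsDedekindDomain Filter

set_option linter.dupNamespace false

namespace Summit.Langlands.Langlands.Cruxes.DescentGL2.Birth

/-- The crux with `F' := F` (literally `h F ℓ ι ρ F`, see `descentGL2Self_of`). [folklore] -/
def DescentGL2Self : Prop :=
  ∀ (F : Type) [Field F] [NumberField F] (ℓ : ℕ) [Fact ℓ.Prime] (ι : PadicAlgCl ℓ ≃+* ℂ)
    (ρ : FramedGaloisRep F (PadicAlgCl ℓ) 2),
    ρ.toGaloisRep.IsIrreducible → (ρ.restrictField F).toGaloisRep.IsIrreducible →
    (∀ (E : Type) [Field E] [NumberField E] [Algebra F E] [Algebra E F] [IsScalarTower F E F],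
      IsSolvable (F ≃ₐ[E] F) →
      ∃ (hE : isCompact_glFiniteIntegralLevel 2 E) (π : CuspidalAutomorphicRepData 2 E hE),
        π.1.IsLAlgebraic ∧ ∀ᶠ w : HeightOneSpectrum (𝓞 E) in cofinite,
          Summit.Langlands.SatakeFrobCompatibleAt ι π.1 (ρ.restrictField E) w) →
    ∀ (hF : isCompact_glFiniteIntegralLevel 2 F), ∃ π : CuspidalAutomorphicRepData 2 F hF,
      π.1.IsLAlgebraic ∧ ∀ᶠ v : HeightOneSpectrum (𝓞 F) in cofinite,
        Summit.Langlands.SatakeFrobCompatibleAt ι π.1 ρ v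

/-- `DescentGL2Self` IS the instance `F' := F` of the crux. [folklore] -/
theorem descentGL2Self_of (h : DescentGL2) : DescentGL2Self :=
  fun F _ _ ℓ _ ι ρ => h F ℓ ι ρ F

/-- **The degenerate tower holds unconditionally** (BC5 special case of the crux): take `E := F` in the
hypothesis (`Gal(F/F)` is trivial, hence soluble) and transport the a.e. Satake–Frobenius compatibility from
`ρ.restrictField F` back to `ρ` with the tree's descent lemmas at completely split places (`e = f = 1`
trivially for `F/F`). [folklore] -/
theorem descentGL2Self_holds : DescentGL2Self := by
  intro F _ _ ℓ _ ι ρ hirr hirr' hpot hF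
  obtain ⟨hE, π, hL, hae⟩ := hpot F inferInstance
  refine ⟨π, hL, ?_⟩
  -- `e(v) = f(v) = 1` in `F/F`
  have hef : ∀ v : HeightOneSpectrum (𝓞 F),
      v.asIdeal.ramificationIdxIn (𝓞 F) = 1 ∧ v.asIdeal.inertiaDegIn (𝓞 F) = 1 := fun v =>
    PatchingFamily.ramificationIdxIn_eq_one_of_ncard_eq_finrank (K := F) (M := F) v (by
      rw [Module.finrank_self]
      have hset : v.asIdeal.primesOver (𝓞 F) = {v.asIdeal} := by
        ext P
        simp only [Ideal.primesOver, Set.mem_setOf_eq, Set.mem_singleton_iff]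
        constructor
        · rintro ⟨hP, hover⟩
          rw [hover.over]
          ext x
          simp [Ideal.under]
        · rintro rfl
          exact ⟨v.isPrime, ⟨by ext x; simp [Ideal.under]⟩⟩
      -- `Algebra.id (𝓞 F)` and the instance induced from `Algebra.id F` agree by `rfl` (Mathlib), so `exact`
      -- (defeq) rather than `rw` (syntactic) bridges the two elaborations of `primesOver`.
      exact (congrArg Set.ncard hset).trans (Set.ncard_singleton _))
  -- the only place of `F` above `v` is `v`
  have hunder : ∀ {v w : HeightOneSpectrum (𝓞 F)}, w.asIdeal.under (𝓞 F) = v.asIdeal → w = v := by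
    intro v w hw
    have h1 : w.asIdeal.under (𝓞 F) = w.asIdeal := by
      ext x
      simp [Ideal.under]
    exact HeightOneSpectrum.ext (h1.symm.trans hw)
  filter_upwards [hae] with v hv
  obtain ⟨α, hα, hunr, hchar⟩ := hv
  have hunr' : ρ.IsUnramifiedAt v :=
    FramedGaloisRep.isUnramifiedAt_of_restrictField (M := F) ρ (hef v).1
      (fun w hw => by cases hunder hw; exact hunr)
  exact ⟨α, hα, hunr', FramedGaloisRep.hasFrobCharpolyAt_of_restrictField (M := F) ρ hunr' (hef v).2
      (fun w hw => by cases hunder hw; exact hchar)⟩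

/-- Sanity: the special case is consistent with the crux both ways round. -/
example : DescentGL2 → DescentGL2Self := descentGL2Self_of
example : DescentGL2Self := descentGL2Self_holds

end Summit.Langlands.Langlands.Cruxes.DescentGL2.Birth
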